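import Literature.Geometry.Lorentzian.InitialData
import Literature.Geometry.Lorentzian.Isometry
import Literature.Geometry.Lorentzian.AsymptoticFlatness
import Literature.Geometry.Lorentzian.TrappedSurface
import Literature.Topology.FourManifolds.SmoothOrientation
import HarnessLib
import HarnessLib.Audit

-- provenance: harness21/H21/H21/Statements/GR/MassInequalities.lean @ 3f3299e (interim HEAD d8f2665); M5 mechanical rewrite
/-!
# Mass inequalities: positive mass theorem and Penrose inequalities
(family `gr`, statements **gr.S10**, **gr.S09**, **gr.S08**; trunk G08 = T-LORENTZ, outline
`H21/Outlines/Lorentz.md` §3 ST2, item `GRMassInequalities`; namespace `Literature.GR`)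

Let `(X, h, k)` be a `3`-dimensional initial data set (`D : InitialDataSet (𝓡 3) X` on a
connected, Hausdorff, second countable smooth `3`-manifold `X`) with an asymptotically flat end
`e : AFEnd X` (open-end design of `AsymptoticFlatness.lean`), ADM energy `E = e.admEnergy D`,
ADM momentum `P = e.admMomentum D` and ADM mass `m = √(E² - |P|²) = e.admMass D`.

All six results of gr.S10/gr.S09 are theorems in print that are far out of reach of Mathlib; in
the sorry-free `Literature/` regime (D-0014) each is vendored as a **named fact**
`def <name> : Prop := <statement>`, a closed proposition (universally quantified over the data
manifold `X : Type`, exactly like `PenroseInequalityConjecture`), whose hypotheses are those *of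
the printed theorem its cite tag names* (or stronger), so that no fact is stronger than its
source. Users take `(h : <name>)` as a hypothesis and instantiate it. **Known exception and
deprecations** (found after landing): the facts built on the hypothesis structure `OutermostMOTS`
of `TrappedSurface.lean` (`riemannian_penrose_inequality_connected`,
`riemannian_penrose_inequality`, `riemannian_penrose_rigidity`, and in intent
`PenroseInequalityConjecture`) are **mis-stated**: the normal field `S.ν` of that structure
carries no regularity, so `S.isMOTS` does not force the horizon to be minimal where `S.exterior`
is two-sided — see the docstring heading the section *gr.S09* below. The corrected forms add the
smoothness of `S.ν` and nothing else: `riemannian_penrose_inequality_connected_smooth` (this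
file), `riemannian_penrose_inequality_smooth` (`OutermostHorizon.lean`) and
`riemannian_penrose_rigidity_smooth` (`PenroseRigidity.lean`). Accordingly all three —
`riemannian_penrose_inequality_connected`, `riemannian_penrose_inequality` and
`riemannian_penrose_rigidity` — are **deprecated** (2026-08-15, `@[deprecated]`, statements kept
verbatim under their ledger-referenced names).

* **gr.S10** (positive mass theorem).
  `positive_mass_theorem_riemannian`: time-symmetric (`k = 0`), complete, one-ended data,
  asymptotically flat of order `1` with sources decaying like `r^{-3-q₀}` in `C¹`
  (`HasSourceDecay`), `R(h) ≥ 0` ⟹ `E ≥ 0` — the time-symmetric case of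
  Eichmair–Huang–Lee–Schoen 2016, Thm. 1 (historically Schoen–Yau 1979, Witten 1981);
  `positive_mass_rigidity`: Schoen–Yau 1979, Thm. 2 verbatim — oriented, strongly asymptotically
  flat with mass parameter `M = 0` (`h - δ = o₅(r⁻²)`), `R(h) ≥ 0` ⟹ `(X, h) ≅ (ℝ³, δ)`
  isometrically; `positive_mass_theorem_spacetime`: Eichmair–Huang–Lee–Schoen 2016, Thm. 1 for
  `n = 3` — complete one-ended data, dominant energy condition, asymptotically flat of order `1`
  with `HasSourceDecay` ⟹ `|P| ≤ E`.
* **gr.S09** (Riemannian Penrose inequality). For time-symmetric complete data with `R(h) ≥ 0`,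
  asymptotically flat of order `1` on the end `e`, and an outermost minimal surface `S`
  (`S : OutermostMOTS (𝓡 3) D.h 0`) whose exterior region is connected, contains the end `e` and
  is compact modulo that end (`IsExteriorRegion`), `√(|S|/16π) ≤ E`:
  `riemannian_penrose_inequality_connected_smooth` (Huisken–Ilmanen 2001, Main Theorem,
  connected horizon with smooth unit normal; the deprecated `riemannian_penrose_inequality_connected`
  is the same without the smoothness of `S.ν`, see above) and, for any horizon,
  `riemannian_penrose_inequality_smooth` of `OutermostHorizon.lean` (Bray 2001, Thms. 1 and 19,
  under Bray's extra decay `|R(h)| = O(r^{-q})`, `q > 3`, of his Def. 21, horizon with smooth unit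
  normal; the deprecated `riemannian_penrose_inequality` of this file is the same without the
  smoothness of `S.ν`, mis-stated likewise); rigidity — equality forces the exterior region to
  be isometric to the time-symmetric Schwarzschild exterior `({E/2 < ‖y‖}, (1 + E/2‖y‖)⁴ δ)`
  (Bray 2001, Thms. 1 and 19, equality case): `riemannian_penrose_rigidity_smooth` of
  `PenroseRigidity.lean` (the deprecated `riemannian_penrose_rigidity` of this file is the same
  without the smoothness of `S.ν`).
* **gr.S08** (Penrose inequality conjecture, open). `PenroseInequalityConjecture : Prop`: for
  complete asymptotically flat data satisfying the dominant energy condition with an outermost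
  MOTS `S` of area `A` (w.r.t. the measured end), `√(A/16π) ≤ m_ADM` (Penrose 1973; Mars 2009).
  Stated as a `def` only.

## Mathlib

Mathlib (at the pin) has none of: ADM mass, positive mass theorem, Penrose inequality, MOTS
(`rg -i 'positive mass|penrose ineq|ADM' Mathlib` finds nothing relevant). We use Mathlib's
`Diffeomorph`, `innerSL ℝ` (the Euclidean metric `δ` on `E3 = EuclideanSpace ℝ (Fin 3)`),
`iteratedFDeriv`, `Asymptotics.IsBigO` along `Bornology.cobounded`, `Real.sqrt`, `Real.pi`,
`ENNReal.toReal`, `TopologicalSpace.Opens` as open submanifolds, and the H21 Lorentz prelude: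
`InitialDataSet` (+ `IsTimeSymmetric`, `IsComplete`, `SatisfiesDominantEnergyCondition`,
`energyDensity`, `momentumDensity`, `metric`), `PseudoRiemannianMetric.scalarCurvature`,
`pullbackBilin`, `AFEnd` (+ `IsAsymptoticallyFlat`, `IsStronglyAsymptoticallyFlatWith`,
`IsSoleEnd`, `far`, `dataChart`, `HasADMEnergy`, `HasADMMomentum`, `admEnergy`, `admMomentum`,
`admMass`, `scalarCurvatureCoeff`), `OutermostMOTS` (+ `surfaceArea`, `exterior`, `surf`),
`IsMOTSInData`, `IsWeaklyOuterTrapped`, `IsMaximalSlice` (minimal surface), `NormalField`,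
`contMDiff_pullbackBilin`, `curveThrough`, `exteriorRegion`, and `IsOrientable` of
`Literature.Topology.FourManifolds.SmoothOrientation`.

## Design choices

* *Named facts, closed over `X`.* Each fact quantifies over
  `(X : Type) [TopologicalSpace X] [ChartedSpace E3 X] [IsManifold (𝓡 3) ∞ X] [T2Space X]
  [SecondCountableTopology X] [ConnectedSpace X]` (universe `0`, as in
  `PenroseInequalityConjecture`; `OutermostMOTS` itself quantifies over surface types in `Type`)
  and over the standing Levi-Civita instance `[D.metric.HasLeviCivita]` of `InitialData.lean`
  (a true `Prop`-valued fact needed to *state* scalar curvature, completeness and the energy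
  condition). Nothing imports the former sorried theorems (`lean search`), so no `_of` rewiring
  is shipped; likewise no bridge from a deprecated fact to its corrected form is kept here (the
  deprecated statement implies the corrected one trivially, by supplying the extra hypothesis;
  the one pre-existing downstream bridge, `riemannian_penrose_inequality_smooth_of` of
  `OutermostHorizon.lean`, is itself deprecated).
* *ADM quantities are limits.* `admEnergy`/`admMomentum` are `limUnder`s with junk values when
  the flux limits do not exist; every statement mentioning them carries the honest existence
  hypotheses `∃ m, e.HasADMEnergy D m` (and `∀ i, ∃ p, e.HasADMMomentum D i p` where `P` enters).
  The sources assert these limits exist under their decay hypotheses (Bartnik's theorem;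
  EHLS §2; Bray (225); Huisken–Ilmanen (0.2)), so the extra hypotheses only weaken the facts.
* *Decay classes (faithfulness).* `AFEnd.IsAsymptoticallyFlat e D 1` is `C²`/`C¹` decay
  `h - δ = O₂(r⁻¹)`, `k = O₁(r⁻²)` in the chart of the end. It implies Huisken–Ilmanen's (0.1)
  (`|h - δ| ≤ C/|x|`, `|∂h| ≤ C/|x|²`, `Rc ≥ -C h/|x|²`) and, for every `q ∈ (1/2, 1)` and
  `p > 3`, the weighted Sobolev decay `(h - δ, k) ∈ W^{2,p}_{-q} × W^{1,p}_{-1-q}` of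
  Eichmair–Huang–Lee–Schoen (§2, asymptotic flatness of type `(p, q, q₀, α)`: the integrand
  `(|∂^I f| |x|^{|I|+q})^p |x|^{-3}` is `O(|x|^{(q-1)p-3})`, integrable at infinity), and Bray's
  `h = δ + O₂(|x|^{-p})`, `p > 1/2` (Def. 21). What order-`1` decay does *not* give is control of
  the sources: EHLS additionally require `(μ, J) ∈ C^{0,α}_{-3-q₀}` for some `q₀ > 0`, and Bray
  `|R(h)| = O(|x|^{-q})` for some `q > 3`. These are therefore explicit hypotheses:
  `HasSourceDecay e D q₀` (the `C¹`-weighted form `|∂^m μ| , |∂^m Jᵢ| = O(r^{-3-q₀-m})`,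
  `m ≤ 1`, in the chart, which implies the weighted `C^{0,α}` condition by the mean value
  theorem on balls `B_{|x|/2}(x)`) for the two EHLS facts, and the `IsBigO` hypothesis on
  `scalarCurvatureCoeff` for the two Bray facts. Schoen–Yau 1979 assume the
  asymptotically Schwarzschildean expansion (1.1) `h = (1 + M/2r)⁴ δ + O₂(r⁻²)` and, for
  rigidity, (1.2) `|∂³h| + |∂⁴h| + |∂⁵h| ≤ k₄ r⁻⁵`, plus orientedness; `positive_mass_rigidity`
  assumes `IsOrientable (𝓡 3) X` and `IsStronglyAsymptoticallyFlatWith e D 0 2 0 5 0`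
  (`h - δ = o₅(r⁻²)`, which implies (1.1)–(1.2) with `M = 0` on a slightly smaller end;
  `(1 + M/2r)⁴ - (1 + 2M/r) = O_∞(r⁻²)` makes the two normalisations of the mass term agree).
  Their "total mass" *is* the expansion parameter `M` (p. 47), so "the total mass is zero" is
  the hypothesis `M = 0` and no ADM limit enters that fact.
* *Riemannian Penrose inequality: the horizon.* The horizon is an `OutermostMOTS (𝓡 3) D.h 0`
  (hypothesis structure of `TrappedSurface.lean`: a compact embedded minimal surface bounding an
  open `exterior` region, into which its normal points, with no weakly outer trapped — for
  `k = 0`: `H ≤ 0` — surface in the exterior enclosing the whole of `S` with compact region in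
  between). "The exterior is the region between the horizon and the measured end `e`, compact
  modulo the end" is the local predicate `IsExteriorRegion e S.exterior`: `S.exterior` is
  *connected*, contains `e.far R'` for some `R' > e.R`, and `closure S.exterior \ e.far R'` is
  compact. Connectedness is indispensable: `OutermostMOTS` alone allows `S.exterior` to be the
  true exterior together with a separate interior layer bounded by further minimal surfaces (a
  "bag of gold" neck of large area), whose areas `S.surfaceArea` would count, and the inequality
  would fail. With connectedness every component of `S` borders the unbounded side, `S.exterior`
  has exactly the one end `e`, so no separate `IsSoleEnd` hypothesis is needed and the part of
  `X` inside the horizon is unconstrained (it may contain further ends; completeness of `X` is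
  assumed nevertheless). The area `|S| = S.surfaceArea` is the `μHE[2]`-normalised Riemannian
  area of the induced metric, finite (`OutermostMOTS.surfaceArea_lt_top`), entering through
  `ENNReal.toReal`.
* *Reduction to the printed horizons.* (a) Huisken–Ilmanen's Main Theorem is stated for an
  *exterior region* `M'` (connected, asymptotically flat, compact minimal boundary, no other
  compact minimal surfaces) and bounds `m` by the area of *any component* `N` of `∂M'`; by their
  Lemma 4.1 the metric completion `M'` of the component of the complement of the trapped set
  containing the end `e` is an exterior region with `∂M'` a finite union of minimal spheres, and
  a *connected* `OutermostMOTS` `S` with `IsExteriorRegion e S.exterior` is one of these spheres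
  (a boundary sphere meeting `closure S.exterior` either equals `S`, by the maximum principle,
  or lies in `S.exterior`; if all lay in `S.exterior` they would form an `H = 0 ≤ 0` surface
  enclosing `S` with compact region in between, excluded by
  `OutermostMOTS.no_weaklyOuterTrapped_in_exterior`). Hence no minimal-surface-freeness is
  needed in `riemannian_penrose_inequality_connected_smooth`. For that corrected statement
  (smooth `S.ν`) this reduction is machine-checked: `ExteriorRegion.lean` vendors Lemma 4.1 (i)
  (`exteriorRegion_structure`), the Main Theorem for exterior regions
  (`riemannian_penrose_inequality_exteriorRegion`) and the boundary maximum principle as named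
  facts and proves `riemannian_penrose_inequality_connected_smooth` from them
  (`riemannian_penrose_inequality_connected_smooth_of_exteriorRegion`; with the maximum
  principle discharged from the local barrier principle,
  `riemannian_penrose_inequality_connected_smooth_of_barrierPrinciple` of
  `MinimalSurfaceBarrier.lean`). (b) Bray's Thm. 19 is stated for a
  complete asymptotically flat `3`-manifold *with boundary* whose boundary is an
  outer-minimizing horizon of total area `A`; it is applied to Huisken–Ilmanen's exterior
  region `M'` of the end `e` (Lemma 4.1: the metric completion of the component `M'°` of the
  complement of the trapped set containing the end; complete, one end, boundary a finite union
  of minimal spheres, no other compact minimal surfaces — so `∂M'` is *outermost* in Bray's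
  sense, Def. 5, and "outermost horizons are always strictly outer minimizing", Bray, p. 185,
  before Thm. 1). For a possibly disconnected `S` the general-horizon facts carry
  `IsMinimalSurfaceFree D.h S.exterior` (no closed minimal surface inside the open exterior —
  Huisken–Ilmanen's hypothesis (iii)): every boundary sphere of `M'` lies in
  `closure S.exterior = S.exterior ∪ S`, hence (maximum principle) in `S`, so the connected set
  `S.exterior ⊇ M'°` does not meet `∂M'` and `S.exterior = M'°`; thus `∂M'` projects onto
  `frontier S.exterior = S` and has total area `A ≥ |S|` (with equality unless `S.exterior`
  lies on both sides of a component of `S`, which the metric completion doubles). Thm. 19 then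
  gives `m ≥ √(A/16π) ≥ √(|S|/16π)`, and in the equality case `A = |S|` and `M'° = S.exterior`
  is the Schwarzschild exterior. (Machine-checked for the corrected statement, with the
  outermost hypothesis in the printed form of Huisken–Ilmanen's condition (iii):
  `riemannian_penrose_inequality_outermost_of_exteriorRegion`, `OutermostHorizon.lean`.)
* *One-sided surfaces.* Both local outermost-type predicates quantify over surfaces with a
  global unit normal, so one-sided closed surfaces are not literally excluded — harmless, since
  a one-sided closed minimal (resp. weakly outer trapped) surface yields a two-sided one as the
  boundary of a thin tubular neighbourhood minimised in its isotopy class.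
* *Empty horizon.* `OutermostMOTS` does not exclude `S.surf = ∅` (then `|S| = 0` and the
  inequality is the positive mass theorem). The rigidity statement would be false in that
  degenerate case, so the rigidity facts assume `Nonempty S.surf`.
* *Rigidity models without `ModelData`.* The isometries are stated with `pullbackBilin`
  directly (this is `PseudoRiemannianMetric.IsIsometry` of `Isometry.lean`, unfolded, against
  the fibrewise forms): positive mass rigidity as a diffeomorphism `Φ : X ≅ E3` with
  `Φ^* δ = h`; Penrose rigidity as a diffeomorphism `Φ : S.exterior ≅ exteriorRegion (E/2) =
  {E/2 < ‖y‖} ⊆ E3` with `Φ^* ((1 + E/(2‖y‖))⁴ δ) = h|_{S.exterior}` (Bray (12): the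
  Schwarzschild manifold `(ℝ³ ∖ {0}, (1 + m/2r)⁴ δ)` of total mass `m` outside its horizon
  `r = m/2`; the total mass is an isometry invariant of the end, so `m = E`). This avoids the
  import of `ModelData.lean` (whose `trivialData`/`Schwarzschild.timeSymmetricExteriorData`
  package the same fibrewise forms) and the restriction API.
* *Spacetime Penrose conjecture.* Only the sub-case in which the region inside the horizon is
  kept as part of a complete `X` is formalised (the general conjecture allows data with
  boundary `∂X = S`); the outermost condition and the area refer to the MOTS `S` and the
  measured end `e` as in gr.S09 (plus `IsWeaklyOuterTrappedFree`), and the mass is the ADM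
  mass `√(E² - |P|²)`.

## References

* R. Schoen, S.-T. Yau, *On the proof of the positive mass conjecture in general relativity*,
  Comm. Math. Phys. 65 (1979) 45–76: §1, (1.1)–(1.2), Thm. 1 and Thm. 2 (p. 48).
* E. Witten, *A new proof of the positive energy theorem*, Comm. Math. Phys. 80 (1981) 381–402;
  T. Parker, C. H. Taubes, *On Witten's proof of the positive energy theorem*, Comm. Math.
  Phys. 84 (1982) 223–238, §1.
* M. Eichmair, L.-H. Huang, D. A. Lee, R. Schoen, *The spacetime positive mass theorem in
  dimensions less than eight*, J. Eur. Math. Soc. 18 (2016) 83–121 (arXiv:1110.2087): Thm. 1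
  (p. 1), §2 Defs. 1–3 and asymptotic flatness of type `(p, q, q₀, α)` (pp. 5–6), and p. 2
  (time-symmetric case: the dominant energy condition is `R ≥ 0`).
* G. Huisken, T. Ilmanen, *The inverse mean curvature flow and the Riemannian Penrose
  inequality*, J. Differential Geom. 59 (2001) 353–437: (0.1)–(0.3) and Main Theorem (§0),
  Lemma 4.1 (§4).
* H. L. Bray, *Proof of the Riemannian Penrose inequality using the positive mass theorem*,
  J. Differential Geom. 59 (2001) 177–267: Defs. 3–6 and Thm. 1 (pp. 184–185), (12),
  Def. 21 (pp. 238–239) and (225) (p. 239), Thm. 19 (p. 240).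
* R. Penrose, *Naked singularities*, Ann. New York Acad. Sci. 224 (1973) 125–134.
* M. Mars, *Present status of the Penrose inequality*, Class. Quantum Grav. 26 (2009) 193001,
  §2–§3.
* L. Andersson, J. Metzger, *The area of horizons and the trapped region*, Comm. Math. Phys.
  290 (2009) 941–972 (arXiv:0708.4252): §7, Defs. 7.1–7.2 (weakly outer trapped set, trapped
  region) and Thm. 7.3 (= Thm. 1.3: its boundary is a smooth outermost MOTS).
* R. Bartnik, *The mass of an asymptotically flat manifold*, Comm. Pure Appl. Math. 39 (1986)
  661–693, §4.
-/

noncomputable section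

open Bundle Set Manifold TopologicalSpace Filter MeasureTheory Asymptotics
open scoped ContDiff Topology ENNReal Manifold Real

namespace Literature.Geometry.Lorentzian


variable {X : Type} [TopologicalSpace X] [ChartedSpace E3 X] [IsManifold (𝓡 3) ∞ X]

/-- Bridge for the standing Levi-Civita hypothesis: `D.metric` is by definition
`PseudoRiemannianMetric.ofRiemannian D.h` (`InitialDataSet.metric`), but instance resolution
does not unfold this plain definition, so the instance argument `[D.metric.HasLeviCivita]` of
`InitialData.lean` is re-exported under the syntactic form that the hypersurface API
(`IsMaximalSlice`, `IsWeaklyOuterTrapped`, applied to `ofRiemannian D.h`) asks for. A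
`Prop`-valued instance whose premise and conclusion are definitionally, not syntactically,
equal (no loop). O'Neill 1983, Ch. 3, Thm. 3.11 (existence of the Levi-Civita connection).
[folklore] -/
instance InitialDataSet.hasLeviCivita_ofRiemannian (D : InitialDataSet (𝓡 3) X)
    [hD : D.metric.HasLeviCivita] : (PseudoRiemannianMetric.ofRiemannian D.h).HasLeviCivita :=
  hD

/-! ### Outermost conditions on an open region -/

/-- *`U` is free of closed minimal surfaces* for the Riemannian metric `h` (the hypothesis
"`M` contains no other compact minimal surfaces" of Huisken–Ilmanen, J. Differential Geom. 59
(2001), Main Theorem, condition (iii); cf. Bray, J. Differential Geom. 59 (2001), Defs. 4–5,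
"outermost horizon"): there is no nonempty compact smoothly embedded surface `f' : S' → X` (a
`2`-manifold without boundary, `S' : Type`) with image in `U`, unit normal `ν'`, and vanishing
mean curvature `H = 0` (`IsMaximalSlice`, i.e. a MOTS of the time-symmetric data `(h, 0)`,
`isMOTSInData_zero_iff`); `hpb'` is the pullback-smoothness fact of `Isometry.lean` needed to
state mean curvature. The guard `Nonempty S'` is needed since the predicate is vacuous on the
empty surface. Used with `U = S.exterior` to make an `OutermostMOTS` outermost *componentwise*
(the structure field `no_weaklyOuterTrapped_in_exterior` only excludes surfaces enclosing the
whole of `S`). [cite: HuiskenIlmanenIMCF2001, Main Theorem condition (iii)] -/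
def IsMinimalSurfaceFree
    (h : ContMDiffRiemannianMetric (𝓡 3) ∞ E3 (TangentSpace (𝓡 3) : X → Type _))
    [(PseudoRiemannianMetric.ofRiemannian h).HasLeviCivita] (U : Opens X) : Prop :=
  ∀ (S' : Type) [TopologicalSpace S'] [ChartedSpace (EuclideanSpace ℝ (Fin 2)) S']
    [IsManifold (𝓡 2) ∞ S'] [CompactSpace S'] [T2Space S'] (f' : S' → X)
    (ν' : NormalField (𝓡 3) f')
    (hpb' : PseudoRiemannianMetric.contMDiff_pullbackBilin (𝓡 3) X (𝓡 2) S' ∞)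
    (hf' : (PseudoRiemannianMetric.ofRiemannian h).IsSpacelikeImmersion (𝓡 2) f'),
    Manifold.IsSmoothEmbedding (𝓡 2) (𝓡 3) ∞ f' → Set.range f' ⊆ (U : Set X) →
    (PseudoRiemannianMetric.ofRiemannian h).IsUnitNormal (𝓡 2) f' ν' 1 → Nonempty S' →
    ¬ (PseudoRiemannianMetric.ofRiemannian h).IsMaximalSlice f' hpb' hf' ν'

/-- *`U` is free of surfaces weakly outer trapped towards the end `e`* in the data `(X, h, k)`
(Andersson–Metzger, Comm. Math. Phys. 290 (2009), Defs. 7.1–7.2 ("weakly outer trapped set",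
"trapped region" of an end) and Thm. 7.3, arXiv:0708.4252 numbering; Mars, Class. Quantum Grav. 26
(2009) 193001, §2; Andersson–Mars–Simon, ATMP 12
(2008), Def. 2): there is no nonempty compact smoothly embedded surface `f' : S' → X` with
image in `U` which is the boundary `frontier Ω = range f'` of an open region `Ω ⊆ X` lying
*away from the end* `e` (`Ω` is disjoint from `e.far R'` for some `R' > e.R`; `Ω` need not be
precompact — it may hide further ends behind a neck), whose unit normal `ν'` points *out of*
`Ω`, i.e. towards the end (the chart-straight curve through `f' y` with velocity `ν' y` lies in
`Ω` for small `t < 0`, the pattern of `OutermostMOTS.pointsInto`), and which is weakly outer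
trapped, `θ⁺ = tr_{S'} k + H ≤ 0` (`IsWeaklyOuterTrapped h k`). The orientation datum `Ω` is
essential for `k ≠ 0` (with the inward normal every small round sphere has `θ⁺ < 0`), and
`Ω = X \ range f'` is excluded by the disjointness from the end. If `S` is the boundary of
the outermost trapped region `T` of the end `e` (the union of all such `Ω`), then
`U = S.exterior` satisfies this.
[cite: AnderssonMetzgerTrapped2009, Defs. 7.1–7.2 and Thm. 7.3 (arXiv:0708.4252 numbering)] -/
def IsWeaklyOuterTrappedFree
    (h : ContMDiffRiemannianMetric (𝓡 3) ∞ E3 (TangentSpace (𝓡 3) : X → Type _))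
    [(PseudoRiemannianMetric.ofRiemannian h).HasLeviCivita]
    (k : Π x : X, TangentSpace (𝓡 3) x →L[ℝ] TangentSpace (𝓡 3) x →L[ℝ] ℝ) (e : AFEnd X)
    (U : Opens X) : Prop :=
  ∀ (S' : Type) [TopologicalSpace S'] [ChartedSpace (EuclideanSpace ℝ (Fin 2)) S']
    [IsManifold (𝓡 2) ∞ S'] [CompactSpace S'] [T2Space S'] (f' : S' → X)
    (ν' : NormalField (𝓡 3) f')
    (hpb' : PseudoRiemannianMetric.contMDiff_pullbackBilin (𝓡 3) X (𝓡 2) S' ∞)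
    (hf' : (PseudoRiemannianMetric.ofRiemannian h).IsSpacelikeImmersion (𝓡 2) f')
    (Ω : Opens X),
    Manifold.IsSmoothEmbedding (𝓡 2) (𝓡 3) ∞ f' → Set.range f' ⊆ (U : Set X) →
    (PseudoRiemannianMetric.ofRiemannian h).IsUnitNormal (𝓡 2) f' ν' 1 → Nonempty S' →
    frontier (Ω : Set X) = Set.range f' → (∃ R', e.R < R' ∧ Disjoint (e.far R') (Ω : Set X)) →
    (∀ y, ∀ᶠ t in 𝓝[<] (0 : ℝ), curveThrough (𝓡 3) (f' y) (ν' y) t ∈ (Ω : Set X)) →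
    ¬ IsWeaklyOuterTrapped h k f' hpb' hf' ν'

/-- A region of time-symmetric data free of surfaces weakly outer trapped towards `e` contains
no closed minimal surface bounding a region away from `e`: `IsWeaklyOuterTrappedFree`
specialises, for `k = 0`, to the boundary case of `IsMinimalSurfaceFree` (a minimal surface is
a MOTS, hence weakly outer trapped, for `k = 0`; Huisken–Ilmanen 2001, §1; Andersson–Mars–Simon
2008, Def. 2). [cite: HuiskenIlmanenIMCF2001, §1] -/
lemma IsWeaklyOuterTrappedFree.not_isMaximalSlice
    {D : InitialDataSet (𝓡 3) X} [(PseudoRiemannianMetric.ofRiemannian D.h).HasLeviCivita]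
    {e : AFEnd X} {U : Opens X}
    (hU : IsWeaklyOuterTrappedFree D.h D.k e U) (hts : D.IsTimeSymmetric)
    (S' : Type) [TopologicalSpace S'] [ChartedSpace (EuclideanSpace ℝ (Fin 2)) S']
    [IsManifold (𝓡 2) ∞ S'] [CompactSpace S'] [T2Space S'] (f' : S' → X)
    (ν' : NormalField (𝓡 3) f')
    (hpb' : PseudoRiemannianMetric.contMDiff_pullbackBilin (𝓡 3) X (𝓡 2) S' ∞)
    (hf' : (PseudoRiemannianMetric.ofRiemannian D.h).IsSpacelikeImmersion (𝓡 2) f')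
    (Ω : Opens X) (hemb : Manifold.IsSmoothEmbedding (𝓡 2) (𝓡 3) ∞ f')
    (hU' : Set.range f' ⊆ (U : Set X))
    (hν : (PseudoRiemannianMetric.ofRiemannian D.h).IsUnitNormal (𝓡 2) f' ν' 1)
    (hne : Nonempty S') (hfr : frontier (Ω : Set X) = Set.range f')
    (hfar : ∃ R', e.R < R' ∧ Disjoint (e.far R') (Ω : Set X))
    (hout : ∀ y, ∀ᶠ t in 𝓝[<] (0 : ℝ), curveThrough (𝓡 3) (f' y) (ν' y) t ∈ (Ω : Set X)) :
    ¬ (PseudoRiemannianMetric.ofRiemannian D.h).IsMaximalSlice f' hpb' hf' ν' := by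
  have hk : D.k = 0 := funext hts
  intro hM
  refine hU S' f' ν' hpb' hf' Ω hemb hU' hν hne hfr hfar hout ?_
  rw [hk]
  exact ((isMOTSInData_zero_iff D.h f' hpb' hf' ν').2 hM).isWeaklyOuterTrapped

/-- *`U` is the exterior region of the end `e`* (Bray, J. Differential Geom. 59 (2001), §2,
"the region outside the outermost horizon"; Huisken–Ilmanen, J. Differential Geom. 59 (2001),
§0 and Lemma 4.1, "exterior region"; Mars, Class. Quantum Grav. 26 (2009) 193001, §2): the
open set `U` is *connected*, contains the far part `e.far R'` of the end for some `R' > e.R`,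
and is compact modulo the end (`closure U \ e.far R'` is compact). Connectedness is essential:
without it an "exterior region" `S.exterior` of an `OutermostMOTS` could consist of the true
exterior plus a separate layer bounded by further minimal surfaces (a "bag of gold" whose neck
has large area), and the Penrose inequalities below would be false. With it, every component
of `S` borders the unbounded side and `U` has exactly the one end `e` (so no separate
`AFEnd.IsSoleEnd` hypothesis is needed and the part of `X` inside the horizon is
unconstrained). [cite: HuiskenIlmanenIMCF2001, §0 exterior region and Lemma 4.1] -/
def IsExteriorRegion (e : AFEnd X) (U : Opens X) : Prop :=
  IsConnected (U : Set X) ∧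
    ∃ R', e.R < R' ∧ e.far R' ⊆ (U : Set X) ∧ IsCompact (closure (U : Set X) \ e.far R')

omit [IsManifold (𝓡 3) ∞ X] in
/-- An exterior region of an end is nonempty (it is connected, in particular nonempty; it
contains the far part of the end). Huisken–Ilmanen 2001, §0. [cite: HuiskenIlmanenIMCF2001, §0] -/
lemma IsExteriorRegion.nonempty {e : AFEnd X} {U : Opens X} (hU : IsExteriorRegion e U) :
    (U : Set X).Nonempty :=
  hU.1.nonempty

omit [IsManifold (𝓡 3) ∞ X] in
/-- An exterior region of an end is connected (first clause of the definition).
Huisken–Ilmanen 2001, §0. [cite: HuiskenIlmanenIMCF2001, §0] -/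
lemma IsExteriorRegion.isConnected {e : AFEnd X} {U : Opens X} (hU : IsExteriorRegion e U) :
    IsConnected (U : Set X) :=
  hU.1

/-! ### Sources read in the chart of an end -/

/-- The **energy density read in the chart** of the end `e`: `μ(Φ x)` for `R < ‖x‖`
(`Φ = e.dataChart` the inverse chart), junk value `0` inside the closed ball `‖x‖ ≤ R`
(invisible along `Bornology.cobounded`; pattern of `AFEnd.scalarCurvatureCoeff`). Here
`μ = D.energyDensity = (R(h) - |k|²_h + (tr_h k)²)/(16π)`, a positive multiple of the `μ` of
Eichmair–Huang–Lee–Schoen, J. Eur. Math. Soc. 18 (2016), Def. 3.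
[cite: EichmairHuangLeeSchoen2016, §2 Def. 3] -/
def energyDensityCoeff (e : AFEnd X) (D : InitialDataSet (𝓡 3) X) [D.metric.HasLeviCivita]
    (x : E3) : ℝ :=
  if hx : e.R < ‖x‖ then D.energyDensity (e.dataChart ⟨x, hx⟩) else 0

/-- The **components of the momentum density read in the chart** of the end `e`:
`Jᵢ(x) = J_{Φ x}(∂ᵢ)`, where `∂ᵢ = dΦ_x eᵢ` is the coordinate vector field of the chart
(`eᵢ = EuclideanSpace.single i 1`, `Φ = e.dataChart`), for `R < ‖x‖`; junk value `0` inside the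
closed ball. Here `J = D.momentumDensity = (div_h k - d(tr_h k))/(8π)`, a positive multiple of
the `J` of Eichmair–Huang–Lee–Schoen, J. Eur. Math. Soc. 18 (2016), Def. 3.
[cite: EichmairHuangLeeSchoen2016, §2 Def. 3] -/
def momentumDensityCoeff (e : AFEnd X) (D : InitialDataSet (𝓡 3) X) [D.metric.HasLeviCivita]
    (i : Fin 3) (x : E3) : ℝ :=
  if hx : e.R < ‖x‖ then
    D.momentumDensity (e.dataChart ⟨x, hx⟩)
      (mfderiv (𝓡 3) (𝓡 3) e.dataChart ⟨x, hx⟩ (EuclideanSpace.single i (1 : ℝ) : E3))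
  else 0

/-- Outside the ball, `energyDensityCoeff` is `μ` composed with the inverse chart.
Eichmair–Huang–Lee–Schoen 2016, Def. 3. [cite: EichmairHuangLeeSchoen2016, §2 Def. 3] -/
theorem energyDensityCoeff_of_lt (e : AFEnd X) (D : InitialDataSet (𝓡 3) X)
    [D.metric.HasLeviCivita] {x : E3} (hx : e.R < ‖x‖) :
    energyDensityCoeff e D x = D.energyDensity (e.dataChart ⟨x, hx⟩) :=
  dif_pos hx

/-- Inside the closed ball `‖x‖ ≤ R`, `energyDensityCoeff` is the junk value `0`.
Eichmair–Huang–Lee–Schoen 2016, Def. 3. [cite: EichmairHuangLeeSchoen2016, §2 Def. 3] -/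
theorem energyDensityCoeff_of_not_lt (e : AFEnd X) (D : InitialDataSet (𝓡 3) X)
    [D.metric.HasLeviCivita] {x : E3} (hx : ¬ e.R < ‖x‖) :
    energyDensityCoeff e D x = 0 :=
  dif_neg hx

/-- Outside the ball, `momentumDensityCoeff` is the `i`-th chart component of `J`.
Eichmair–Huang–Lee–Schoen 2016, Def. 3. [cite: EichmairHuangLeeSchoen2016, §2 Def. 3] -/
theorem momentumDensityCoeff_of_lt (e : AFEnd X) (D : InitialDataSet (𝓡 3) X)
    [D.metric.HasLeviCivita] (i : Fin 3) {x : E3} (hx : e.R < ‖x‖) :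
    momentumDensityCoeff e D i x =
      D.momentumDensity (e.dataChart ⟨x, hx⟩)
        (mfderiv (𝓡 3) (𝓡 3) e.dataChart ⟨x, hx⟩ (EuclideanSpace.single i (1 : ℝ) : E3)) :=
  dif_pos hx

/-- Inside the closed ball `‖x‖ ≤ R`, `momentumDensityCoeff` is the junk value `0`.
Eichmair–Huang–Lee–Schoen 2016, Def. 3. [cite: EichmairHuangLeeSchoen2016, §2 Def. 3] -/
theorem momentumDensityCoeff_of_not_lt (e : AFEnd X) (D : InitialDataSet (𝓡 3) X)
    [D.metric.HasLeviCivita] (i : Fin 3) {x : E3} (hx : ¬ e.R < ‖x‖) :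
    momentumDensityCoeff e D i x = 0 :=
  dif_neg hx

/-- For **time-symmetric** data (`k = 0`) the energy density read in the chart is
`R(h)/(16π)` read in the chart: `μ = (R - |k|² + (tr k)²)/(16π)` with `k = 0`
(`AFEnd.scalarCurvatureCoeff`; the junk values `0` inside the ball agree). Eichmair–Huang–
Lee–Schoen 2016, p. 2 (time-symmetric case).
[cite: EichmairHuangLeeSchoen2016, p. 2 time-symmetric case] -/
theorem energyDensityCoeff_of_isTimeSymmetric (e : AFEnd X) {D : InitialDataSet (𝓡 3) X}
    [D.metric.HasLeviCivita] (hts : D.IsTimeSymmetric) (x : E3) :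
    energyDensityCoeff e D x = (16 * Real.pi)⁻¹ * e.scalarCurvatureCoeff D x := by
  unfold energyDensityCoeff AFEnd.scalarCurvatureCoeff
  split_ifs with hx
  · simp [InitialDataSet.energyDensity, InitialDataSet.hamiltonianConstraintFn,
      hts.normSqK_eq_zero, hts.isMaximalData _, div_eq_inv_mul]
  · simp

/-- For **time-symmetric** data (`k = 0`) the momentum density read in the chart vanishes:
`J = (div k - d(tr k))/(8π) = 0` (`InitialDataSet.IsTimeSymmetric.momentumConstraintFn_eq_zero`).
Eichmair–Huang–Lee–Schoen 2016, p. 2 (`P = 0` in the time-symmetric case).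
[cite: EichmairHuangLeeSchoen2016, p. 2 time-symmetric case] -/
theorem momentumDensityCoeff_of_isTimeSymmetric (e : AFEnd X) {D : InitialDataSet (𝓡 3) X}
    [D.metric.HasLeviCivita] (hts : D.IsTimeSymmetric) (i : Fin 3) (x : E3) :
    momentumDensityCoeff e D i x = 0 := by
  unfold momentumDensityCoeff
  split_ifs with hx
  · simp [InitialDataSet.momentumDensity, hts.momentumConstraintFn_eq_zero]
  · rfl

/-- **Decay of the sources with rate `q₀`** on the end `e` (the `(μ, J)`-clause of asymptotic
flatness of type `(p, q, q₀, α)` of Eichmair–Huang–Lee–Schoen, J. Eur. Math. Soc. 18 (2016),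
§2, in dimension `n = 3`, in a `C¹`-weighted form): `q₀ > 0` and, in the chart of the end,
`|∂^m μ(x)| = O(‖x‖^{-3-q₀-m})` and `|∂^m Jᵢ(x)| = O(‖x‖^{-3-q₀-m})` for `m ≤ 1` and
`i = 1, 2, 3` as `‖x‖ → ∞` (`iteratedFDeriv` along `Bornology.cobounded E3`, exactly as in
`AFEnd.IsAsymptoticallyFlat`). EHLS require `μ, J ∈ C^{0,α}_{-n-q₀}` (weighted Hölder, Def. 2);
the `C¹` form implies it (mean value theorem on the balls `B_{‖x‖/2}(x)`, on which the weights
`‖·‖` are comparable), so facts assuming `HasSourceDecay` are weaker than the printed theorem.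
For time-symmetric data `J = 0` and `μ = R(h)/(16π)`, so the condition is `C¹` decay of the
scalar curvature faster than `r⁻³`.
[cite: EichmairHuangLeeSchoen2016, §2 asymptotic flatness of type (p q q₀ α)] -/
def HasSourceDecay (e : AFEnd X) (D : InitialDataSet (𝓡 3) X) [D.metric.HasLeviCivita]
    (q₀ : ℝ) : Prop :=
  0 < q₀ ∧
  (∀ m : ℕ, m ≤ 1 →
    (fun x ↦ ‖iteratedFDeriv ℝ m (energyDensityCoeff e D) x‖) =O[Bornology.cobounded E3]
      fun x ↦ ‖x‖ ^ (-3 - q₀ - m)) ∧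
  ∀ i : Fin 3, ∀ m : ℕ, m ≤ 1 →
    (fun x ↦ ‖iteratedFDeriv ℝ m (momentumDensityCoeff e D i) x‖) =O[Bornology.cobounded E3]
      fun x ↦ ‖x‖ ^ (-3 - q₀ - m)

/-- The rate of a source-decay hypothesis is positive (first clause).
Eichmair–Huang–Lee–Schoen 2016, §2 (`q₀ > 0`). [cite: EichmairHuangLeeSchoen2016, §2] -/
theorem HasSourceDecay.pos {e : AFEnd X} {D : InitialDataSet (𝓡 3) X} [D.metric.HasLeviCivita]
    {q₀ : ℝ} (h : HasSourceDecay e D q₀) : 0 < q₀ :=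
  h.1

/-- Source decay for the energy density alone (second clause, `m = 0`): `μ = O(r^{-3-q₀})` in
the chart. Eichmair–Huang–Lee–Schoen 2016, §2. [cite: EichmairHuangLeeSchoen2016, §2] -/
theorem HasSourceDecay.energyDensityCoeff_isBigO {e : AFEnd X} {D : InitialDataSet (𝓡 3) X}
    [D.metric.HasLeviCivita] {q₀ : ℝ} (h : HasSourceDecay e D q₀) :
    (fun x ↦ energyDensityCoeff e D x) =O[Bornology.cobounded E3] fun x ↦ ‖x‖ ^ (-3 - q₀) := by
  have h0 := h.2.1 0 (Nat.zero_le 1)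
  simp only [CharP.cast_eq_zero, sub_zero] at h0
  refine (IsBigO.of_norm_left ?_)
  refine h0.congr_left fun x ↦ ?_
  simp

/-! ### gr.S10: the positive mass theorem -/

/-- **gr.S10** (Riemannian positive mass theorem, `E ≥ 0`). Named fact: the time-symmetric
case of Eichmair–Huang–Lee–Schoen, J. Eur. Math. Soc. 18 (2016), Thm. 1 (p. 1): *let
`3 ≤ n < 8` and `(M, g, k)` be an `n`-dimensional asymptotically flat initial data set (Def. 3
and §2: `g` complete, one end `M ∖ K ≅ ℝⁿ ∖ B`, `(g - δ, k) ∈ W^{2,p}_{-q} × W^{1,p}_{-1-q}`,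
`(μ, J) ∈ C^{0,α}_{-n-q₀}`) satisfying the dominant energy condition `μ ≥ |J|_g`; then
`E ≥ |P|`* — for `n = 3` and `k = 0`, where (p. 2) `P = 0` and the dominant energy condition
"becomes the assumption that the scalar curvature of `g` is nonnegative". Hypotheses: `k = 0`;
asymptotic flatness of order `1` on `e` (implies the EHLS Sobolev decay for every
`q ∈ (1/2, 1)`, `p > 3`, module docstring) together with `HasSourceDecay e D q₀` (implies
`(μ, J) ∈ C^{0,α}_{-3-q₀}`); `e` is the only end and `(X, h)` is complete; `R(h) ≥ 0`; and the
ADM energy flux limit exists (EHLS assert this under their hypotheses; it keeps `admEnergy`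
honest). Conclusion: `0 ≤ E` (from `E ≥ |P| ≥ 0`; the EHLS energy (§2) is the flux limit
`admEnergy`, `2(n-1)ω_{n-1} = 16π`). Historically Schoen–Yau, Comm. Math. Phys. 65 (1979),
Thm. 1 (under the stronger expansion (1.1)) and Witten 1981 / Parker–Taubes 1982.
[cite: EichmairHuangLeeSchoen2016, Thm. 1 with p. 2 (time-symmetric case) and §2] -/
def positive_mass_theorem_riemannian : Prop :=
  ∀ (X : Type) [TopologicalSpace X] [ChartedSpace E3 X] [IsManifold (𝓡 3) ∞ X] [T2Space X]
    [SecondCountableTopology X] [ConnectedSpace X]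
    (D : InitialDataSet (𝓡 3) X) [D.metric.HasLeviCivita] (e : AFEnd X),
    D.IsTimeSymmetric → e.IsAsymptoticallyFlat D 1 → (∃ q₀, HasSourceDecay e D q₀) →
    e.IsSoleEnd → D.IsComplete → (∀ x : X, 0 ≤ D.metric.scalarCurvature x) →
    (∃ m, e.HasADMEnergy D m) → 0 ≤ e.admEnergy D

/-- **gr.S10** (positive mass theorem, rigidity). Named fact: Schoen–Yau, Comm. Math. Phys.
65 (1979), Thm. 2 (p. 48), verbatim: *let `N` be an oriented `3`-manifold with an
asymptotically flat metric (§1: `N ∖ K` a finite union of ends `≅ ℝ³ ∖ ball`, on each of which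
(1.1) `ds² = (1 + M/2r)⁴ δ + h`, `|h| ≤ k₁ r⁻²`, `|∂h| ≤ k₂ r⁻³`, `|∂²h| ≤ k₃ r⁻⁴`, the number
`M` being the total mass of the end); suppose for some end (1.2)
`|∂³h| + |∂⁴h| + |∂⁵h| ≤ k₄ r⁻⁵` holds and its total mass is zero; if `R ≥ 0` on `N` then `N`
is isometric to `ℝ³` with the standard metric.* Hypotheses: `X` orientable
(`IsOrientable (𝓡 3) X`); `k = 0` (the Riemannian statement; it also discharges the `k`-clause
of the next hypothesis); `e.IsStronglyAsymptoticallyFlatWith D 0 2 0 5 0`, i.e.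
`h - δ = o₅(r⁻²)` in the chart of `e`, which is (1.1)–(1.2) with mass parameter `M = 0` (on a
slightly smaller end, where `o` beats the constants `kᵢ`); `e` is the only end; `R(h) ≥ 0`.
Conclusion: a diffeomorphism `Φ : X ≅ E3` with `Φ^* δ = h` (`pullbackBilin`, i.e.
`PseudoRiemannianMetric.IsIsometry` onto `(ℝ³, δ)` unfolded; a distance-preserving bijection
between smooth Riemannian manifolds is a smooth diffeomorphism — Myers–Steenrod — so the
`C^∞` `Diffeomorph` is no strengthening of "isometric"). No ADM limit enters: for
Schoen–Yau the total mass *is* the expansion parameter, here `0`.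
[cite: SchoenYauPMT1979, Thm. 2 (p. 48) with (1.1)–(1.2)] -/
def positive_mass_rigidity : Prop :=
  ∀ (X : Type) [TopologicalSpace X] [ChartedSpace E3 X] [IsManifold (𝓡 3) ∞ X] [T2Space X]
    [SecondCountableTopology X] [ConnectedSpace X]
    (D : InitialDataSet (𝓡 3) X) [D.metric.HasLeviCivita] (e : AFEnd X),
    Literature.Topology.FourManifolds.IsOrientable (𝓡 3) X → D.IsTimeSymmetric → e.IsStronglyAsymptoticallyFlatWith D 0 2 0 5 0 →
    e.IsSoleEnd → (∀ x : X, 0 ≤ D.metric.scalarCurvature x) →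
    ∃ Φ : Diffeomorph (𝓡 3) (𝓡 3) X E3 ∞,
      ∀ x : X, pullbackBilin (I := 𝓡 3) (I' := 𝓡 3) Φ
        (fun _ ↦ (innerSL ℝ (E := E3) : E3 →L[ℝ] E3 →L[ℝ] ℝ)) x = D.metric.val x

/-- **gr.S10** (spacetime positive mass theorem `E ≥ |P|`). Named fact: Eichmair–Huang–Lee–
Schoen, J. Eur. Math. Soc. 18 (2016), Thm. 1 (p. 1) for `n = 3`: *let `(M, g, k)` be a
`3`-dimensional asymptotically flat initial data set (Def. 3 and §2: `g` complete, one end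
`M ∖ K ≅ ℝ³ ∖ B`, `(g - δ, k) ∈ W^{2,p}_{-q} × W^{1,p}_{-1-q}` for some `p > 3`,
`q ∈ (1/2, 1)`, and `(μ, J) ∈ C^{0,α}_{-3-q₀}` for some `q₀ > 0`) satisfying the dominant
energy condition `μ ≥ |J|_g`; then `E ≥ |P|`, `(E, P)` the ADM energy–momentum (§2).*
Hypotheses: the dominant energy condition `|J|_h ≤ μ` (`SatisfiesDominantEnergyCondition`; our
`μ`, `J` are EHLS's divided by `8π`); asymptotic flatness of order `1` on `e` (implies the
Sobolev decay, module docstring) and `HasSourceDecay e D q₀` (implies the Hölder decay of the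
sources); `e` is the only end; completeness; existence of the ADM energy and momentum flux
limits (asserted by EHLS §2 under their hypotheses; kept so that `admEnergy`, `admMomentum` are
no junk values). Conclusion: `|P| = √(∑ᵢ Pᵢ²) ≤ E` verbatim (`|P|` is insensitive to the sign
convention for `k`). Historically Schoen–Yau 1981 and Witten 1981 / Parker–Taubes 1982.
[cite: EichmairHuangLeeSchoen2016, Thm. 1 and §2] -/
def positive_mass_theorem_spacetime : Prop :=
  ∀ (X : Type) [TopologicalSpace X] [ChartedSpace E3 X] [IsManifold (𝓡 3) ∞ X] [T2Space X]
    [SecondCountableTopology X] [ConnectedSpace X]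
    (D : InitialDataSet (𝓡 3) X) [D.metric.HasLeviCivita] (e : AFEnd X),
    D.SatisfiesDominantEnergyCondition → e.IsAsymptoticallyFlat D 1 →
    (∃ q₀, HasSourceDecay e D q₀) → e.IsSoleEnd → D.IsComplete →
    (∃ m, e.HasADMEnergy D m) → (∀ i, ∃ p, e.HasADMMomentum D i p) →
    Real.sqrt (∑ i : Fin 3, e.admMomentum D i ^ 2) ≤ e.admEnergy D

/-! ### gr.S09: the Riemannian Penrose inequality

**The horizon structure and its defect (why two facts are deprecated).** The horizon of the
gr.S09 facts is an `S : OutermostMOTS (𝓡 3) D.h 0` (`TrappedSurface.lean`). That hypothesis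
structure imposes no regularity on the unit normal field `S.ν` — a bare `NormalField`, i.e. a
pointwise choice `ν y ∈ T_{f y} X`, constrained only pointwise by `isUnitNormal` and
`pointsInto`. Where `S.exterior` lies on *both* sides of `S` — allowed by `IsExteriorRegion` for a
non-separating horizon with `S.exterior = X ∖ S` (e.g. the throat of a one-ended wormhole, which
Huisken–Ilmanen do cover: the metric completion of Lemma 4.1 doubles it) — `pointsInto` holds for
both signs `±ν`, so `S.ν` may flip sign on a set meeting every arc (a Bernstein-type set). For
such a field every coefficient function `t ↦ cⁱ(ν ∘ c(t))` along the chart-straight curves `c`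
used by `normalDerivAlong` is non-differentiable, so `deriv` returns `0` and the frame formula of
`covariantDerivAlong` (`∑ (cⁱ)' sᵢ + ∑ cⁱ ∇_{γ'} sᵢ`, `Geodesic.lean`) reduces to
`± ∑ cⁱ ∇_{γ'} sᵢ`, which vanishes when the preferred chart `chartAt (f y)` is a normal
coordinate chart centred at `f y` (all Christoffel symbols vanish at the centre); the facts
quantify over all atlases of `X`, including these. Hence `secondFundamentalForm`,
`meanCurvature` and `S.isMOTS` (`H = 0`) can be satisfied by *every* compact embedded surface
with two-sided exterior, minimal or not — surfaces about which the sources, whose horizons are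
smooth minimal surfaces (Huisken–Ilmanen's `∂M`, Bray's Def. 4), say nothing. For the inequality
the assertion `√(|S|/16π) ≤ E` for such non-minimal `S` is presumably false (a coordinate sphere
of area `> 16π E²` around one mouth of a two-mouth one-ended wormhole end (Misner 1960), taken
with `exterior = X ∖ S`, appears to meet every other hypothesis); for the rigidity statement the
Schwarzschild conclusion, which forces a connected `S` with one-sided exterior, fails outright in
such a configuration. For a *one-sided* exterior `pointsInto` pins `ν y` to the outward normal at
every point, so `ν` is the smooth outward normal and no junk arises. The repair adds exactly the
missing hypothesis — `S.ν` smooth as a map into `TX`, under which `S.isMOTS` is the honest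
minimal-surface equation `H = 0` (`secondFundamentalForm_apply`, `covariantDerivAlongFrame_eq`)
— and nothing else: `riemannian_penrose_inequality_connected_smooth` (next),
`riemannian_penrose_inequality_smooth` (`OutermostHorizon.lean`) and
`riemannian_penrose_rigidity_smooth` (`PenroseRigidity.lean`); the natural structural repair is
a smoothness field for `ν` in `OutermostMOTS` itself. The superseded facts
`riemannian_penrose_inequality_connected`, `riemannian_penrose_inequality` and
`riemannian_penrose_rigidity` are **deprecated** (2026-08-15) and kept verbatim, statements
unchanged, under their ledger-referenced names; the intended `PenroseInequalityConjecture` is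
likewise the stated one with `S.ν` smooth. -/

/-- **gr.S09** (Riemannian Penrose inequality, connected horizon; **corrected form** of the
deprecated `riemannian_penrose_inequality_connected` below, see the docstring heading this
section for the discrepancy). Named fact: Huisken–Ilmanen, J. Differential Geom. 59 (2001), Main
Theorem (§0, (0.3)): *let `M` be a complete connected `3`-manifold with (i) nonnegative scalar
curvature, (ii) asymptotically flat satisfying (0.1) with ADM mass `m`, (iii) compact boundary
consisting of minimal surfaces and no other compact minimal surfaces in `M`; then
`m ≥ √(|N|/16π)` for every component `N` of `∂M`* — combined with their Lemma 4.1 (the metric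
completion of the component of the complement of the trapped set containing an end is such an
exterior region, bounded by minimal spheres, a non-separating one counted twice). Hypotheses:
`k = 0`; `R(h) ≥ 0`; asymptotic flatness of order `1` on `e` (implies (0.1)); completeness;
existence of the ADM energy limit (`m = E`); a *connected* outermost minimal surface
`S : OutermostMOTS (𝓡 3) D.h 0` whose exterior is the exterior region of the end `e`
(`IsExteriorRegion`) **and** whose unit normal `S.ν` is smooth as a map into the tangent bundle
(so that `S.isMOTS` is the honest minimal-surface equation `H = 0`, by
`secondFundamentalForm_apply` and `covariantDerivAlongFrame_eq`; automatic for one-sided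
exteriors). Then `S` is one of the boundary spheres `N` of Huisken–Ilmanen's exterior region of
the end `e` (module docstring, *Reduction* (a); machine-checked in `ExteriorRegion.lean` and
`MinimalSurfaceBarrier.lean`), and the Main Theorem gives `√(|S| / 16π) ≤ E`.
[cite: HuiskenIlmanenIMCF2001, Main Theorem (§0) and Lemma 4.1] -/
def riemannian_penrose_inequality_connected_smooth : Prop :=
  ∀ (X : Type) [TopologicalSpace X] [ChartedSpace E3 X] [IsManifold (𝓡 3) ∞ X] [T2Space X]
    [SecondCountableTopology X] [ConnectedSpace X]
    (D : InitialDataSet (𝓡 3) X) [D.metric.HasLeviCivita] (e : AFEnd X)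
    (S : OutermostMOTS (𝓡 3) D.h 0),
    ContMDiff (𝓡 2) (𝓡 3).tangent ∞
      (fun y ↦ (TotalSpace.mk' E3 (S.f y) (S.ν y) : TangentBundle (𝓡 3) X)) →
    D.IsTimeSymmetric → (∀ x : X, 0 ≤ D.metric.scalarCurvature x) →
    e.IsAsymptoticallyFlat D 1 → D.IsComplete → (∃ m, e.HasADMEnergy D m) →
    ConnectedSpace S.surf → IsExteriorRegion e S.exterior →
    Real.sqrt (S.surfaceArea.toReal / (16 * π)) ≤ e.admEnergy D

/-- **Deprecated** (2026-08-15) — **mis-stated**; superseded by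
`riemannian_penrose_inequality_connected_smooth` (above), which adds the one missing hypothesis —
smoothness of the unit normal `S.ν` as a map into `TX` — and keeps every other hypothesis and
the conclusion verbatim. *What is wrong:* the normal field `S.ν` of `OutermostMOTS` carries no
regularity, so for a horizon along which `S.exterior` is two-sided `S.isMOTS` holds for junk
sign-flipping normals of *non-minimal* surfaces, whose area the source does not bound (docstring
heading this section); the statement is therefore not implied by its source — Huisken–Ilmanen,
J. Differential Geom. 59 (2001), Main Theorem (§0), whose `∂M` consists of minimal surfaces —
and is presumably false, so no `_holds` theorem can land. Kept verbatim (statement unchanged)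
under its ledger-referenced name. *Original content* — **gr.S09** (Riemannian Penrose
inequality, connected horizon): for `k = 0`, `R(h) ≥ 0`, asymptotic flatness of order `1` on
`e`, completeness, existence of the ADM energy limit, and a *connected*
`S : OutermostMOTS (𝓡 3) D.h 0` whose exterior is the exterior region of the end `e`
(`IsExteriorRegion`): `√(|S| / 16π) ≤ E` (intended source: the Main Theorem with Lemma 4.1).
[cite: HuiskenIlmanenIMCF2001, Main Theorem (§0) and Lemma 4.1] -/
@[deprecated riemannian_penrose_inequality_connected_smooth (since := "2026-08-15")]
def riemannian_penrose_inequality_connected : Prop :=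
  ∀ (X : Type) [TopologicalSpace X] [ChartedSpace E3 X] [IsManifold (𝓡 3) ∞ X] [T2Space X]
    [SecondCountableTopology X] [ConnectedSpace X]
    (D : InitialDataSet (𝓡 3) X) [D.metric.HasLeviCivita] (e : AFEnd X)
    (S : OutermostMOTS (𝓡 3) D.h 0),
    D.IsTimeSymmetric → (∀ x : X, 0 ≤ D.metric.scalarCurvature x) →
    e.IsAsymptoticallyFlat D 1 → D.IsComplete → (∃ m, e.HasADMEnergy D m) →
    ConnectedSpace S.surf → IsExteriorRegion e S.exterior →
    Real.sqrt (S.surfaceArea.toReal / (16 * π)) ≤ e.admEnergy D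

/-- **Deprecated** (2026-08-15) — **mis-stated**; superseded by
`riemannian_penrose_inequality_smooth` of `Literature/Geometry/Lorentzian/OutermostHorizon.lean`
(declared downstream of this file, whence the text form of the attribute), which adds the one
missing hypothesis — smoothness of the unit normal `S.ν` as a map into `TX` — and keeps every
other hypothesis and the conclusion verbatim; see also `riemannian_penrose_inequality_outermost`
there, with the outermost hypothesis in printed form, reduced in that file to Bray's Thm. 19 for
exterior regions, and the machine-checked reductions of the corrected statement
`riemannian_penrose_inequality_smooth_of_exteriorRegion` /
`riemannian_penrose_inequality_smooth_of_barrierPrinciple` (`OutermostHorizonSmooth.lean`).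
*What is wrong:* `OutermostMOTS.ν` carries no regularity, so along a horizon component on both
of whose sides `S.exterior` lies — allowed by the hypotheses `IsExteriorRegion e S.exterior` and
`IsMinimalSurfaceFree D.h S.exterior` below (a non-separating component, `S.exterior = X ∖ S`) —
`S.isMOTS` holds for junk sign-flipping normals of *non-minimal* surfaces, whose area the sources
do not bound (docstring heading this section); this is not Bray's statement, whose horizons are
smooth zero-mean-curvature surfaces bounding a region (§2, Defs. 3–4, pp. 183–185), so the
statement is not implied by its source and is presumably false — no `_holds` theorem can land.
Kept verbatim
(statement unchanged) under its ledger-referenced name. *Original content* — **gr.S09**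
(Riemannian Penrose inequality, general horizon): named fact: Bray,
J. Differential Geom. 59 (2001), Thm. 19 (p. 240): *let `(M³, g)` be a complete smooth
asymptotically flat `3`-manifold with boundary with nonnegative scalar curvature and total mass
`m`; if the boundary is an outer-minimizing horizon (with one or more components) of total
area `A`, then `m ≥ √(A/16π)`* (Thm. 1, p. 185, is the boundaryless version), where
"asymptotically flat" is Def. 21 (p. 238): ends `≅ ℝ³ ∖ B₁(0)` with
`g = δ + O(|x|^{-p})`, `|x||∂g| + |x|²|∂²g| = O(|x|^{-p})`, `p > 1/2`, **and**
`|R(g)| = O(|x|^{-q})`, `q > 3`, and the total mass is the flux limit (225). Applied to the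
exterior region `M'` of the end `e` (Huisken–Ilmanen, Lemma 4.1), whose interior is
`S.exterior` and whose boundary projects onto `S` under the hypotheses below (module
docstring, *Reduction* (b)). Hypotheses: `k = 0`; `R(h) ≥ 0`; asymptotic
flatness of order `1` on `e` **and** Bray's curvature decay
`scalarCurvatureCoeff e D = O(‖x‖^{-q})` for some `q > 3`; completeness; existence of the ADM
energy limit (`m = E`); an outermost minimal surface `S` (possibly disconnected) whose exterior
is the connected exterior region of the end `e` (`IsExteriorRegion`) containing no closed
minimal surface (`IsMinimalSurfaceFree`) — so that `∂M'` is outermost in Bray's sense (Def. 5),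
hence strictly outer-minimizing (Bray, p. 185, before Thm. 1), of total area `A ≥ |S|`.
Conclusion: `√(|S| / 16π) ≤ E`, `|S|` the total area of `S`.
[cite: BrayRPI2001, Thm. 19 (p. 240) and Thm. 1 with Def. 21]
[cite: HuiskenIlmanenIMCF2001, Lemma 4.1] -/
@[deprecated "mis-stated (the unit normal `S.ν` is unconstrained): use Literature.Geometry.Lorentzian.riemannian_penrose_inequality_smooth of OutermostHorizon.lean" (since := "2026-08-15")]
def riemannian_penrose_inequality : Prop :=
  ∀ (X : Type) [TopologicalSpace X] [ChartedSpace E3 X] [IsManifold (𝓡 3) ∞ X] [T2Space X]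
    [SecondCountableTopology X] [ConnectedSpace X]
    (D : InitialDataSet (𝓡 3) X) [D.metric.HasLeviCivita] (e : AFEnd X)
    (S : OutermostMOTS (𝓡 3) D.h 0),
    D.IsTimeSymmetric → (∀ x : X, 0 ≤ D.metric.scalarCurvature x) →
    e.IsAsymptoticallyFlat D 1 →
    (∃ q : ℝ, 3 < q ∧
      (fun x ↦ e.scalarCurvatureCoeff D x) =O[Bornology.cobounded E3] fun x ↦ ‖x‖ ^ (-q)) →
    D.IsComplete → (∃ m, e.HasADMEnergy D m) →
    IsMinimalSurfaceFree D.h S.exterior → IsExteriorRegion e S.exterior →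
    Real.sqrt (S.surfaceArea.toReal / (16 * π)) ≤ e.admEnergy D

/-- **Deprecated** (2026-08-15) — **mis-stated**; superseded by `riemannian_penrose_rigidity_smooth`
of `Literature/Geometry/Lorentzian/PenroseRigidity.lean` (declared downstream of this file,
whence the text form of the attribute), which adds the one missing hypothesis — smoothness of the
unit normal `S.ν` as a map into `TX` — and keeps every other hypothesis and the conclusion
verbatim; see also `riemannian_penrose_rigidity_outermost` there, with the outermost hypothesis
in printed form, reduced to Bray's Thm. 19 for exterior regions. *What is wrong:*
`OutermostMOTS.ν` carries no regularity, so the hypotheses admit junk `H = 0` normals on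
two-sided horizon components, i.e. non-minimal `S`, for which the Schwarzschild conclusion
(forcing a connected `S` with one-sided exterior) fails; this is not Bray's statement, whose
horizons are smooth zero-mean-curvature surfaces (Def. 4, p. 185), so no `_holds` theorem can
land (docstring heading this section). Kept verbatim (statement unchanged) under its
ledger-referenced name. *Original content* — **gr.S09** (Riemannian Penrose inequality,
rigidity): the direction "equality ⇒ Schwarzschild" of the equality case of Bray,
J. Differential Geom. 59 (2001), Thm. 19 (p. 240) and Thm. 1 (p. 185) — under the hypotheses of
`riemannian_penrose_inequality` and `Nonempty S.surf`, equality `√(|S|/16π) = E` yields a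
diffeomorphism `Φ` of `S.exterior` onto `exteriorRegion (E/2) = {E/2 < ‖y‖} ⊆ E3` with
`Φ^* ((1 + E/(2‖y‖))⁴ δ) = h` there (the Schwarzschild manifold (12) of mass `E` outside its
horizon `r = E/2`).
[cite: BrayRPI2001, Thm. 19 (p. 240) and Thm. 1 equality case with (12)] -/
@[deprecated "mis-stated (the unit normal `S.ν` is unconstrained): use Literature.Geometry.Lorentzian.riemannian_penrose_rigidity_smooth of PenroseRigidity.lean" (since := "2026-08-15")]
def riemannian_penrose_rigidity : Prop :=
  ∀ (X : Type) [TopologicalSpace X] [ChartedSpace E3 X] [IsManifold (𝓡 3) ∞ X] [T2Space X]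
    [SecondCountableTopology X] [ConnectedSpace X]
    (D : InitialDataSet (𝓡 3) X) [D.metric.HasLeviCivita] (e : AFEnd X)
    (S : OutermostMOTS (𝓡 3) D.h 0),
    D.IsTimeSymmetric → (∀ x : X, 0 ≤ D.metric.scalarCurvature x) →
    e.IsAsymptoticallyFlat D 1 →
    (∃ q : ℝ, 3 < q ∧
      (fun x ↦ e.scalarCurvatureCoeff D x) =O[Bornology.cobounded E3] fun x ↦ ‖x‖ ^ (-q)) →
    D.IsComplete → (∃ m, e.HasADMEnergy D m) → Nonempty S.surf →
    IsMinimalSurfaceFree D.h S.exterior → IsExteriorRegion e S.exterior →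
    Real.sqrt (S.surfaceArea.toReal / (16 * π)) = e.admEnergy D →
    ∃ Φ : Diffeomorph (𝓡 3) (𝓡 3) S.exterior (exteriorRegion (e.admEnergy D / 2)) ∞,
      ∀ x : S.exterior, pullbackBilin (I := 𝓡 3) (I' := 𝓡 3) Φ
        (fun y ↦ (1 + e.admEnergy D / (2 * ‖(y : E3)‖)) ^ 4 •
          (innerSL ℝ (E := E3) : E3 →L[ℝ] E3 →L[ℝ] ℝ)) x = D.metric.val x.1

/-! ### gr.S08: the Penrose inequality conjecture -/

/-- **gr.S08** (spacetime Penrose inequality, conjecture — open; Penrose, Ann. New York Acad.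
Sci. 224 (1973); Mars, Class. Quantum Grav. 26 (2009) 193001, §2–§3 (form (W2))). For every
complete initial data set `(X, h, k)` on a connected `3`-manifold `X` (quantified over
`X : Type`, universe `0`) satisfying the dominant energy condition, asymptotically flat of
order `1` on an end `e` whose ADM energy and momentum limits exist, and every outermost MOTS
`S` (`θ⁺ = tr_S k + H = 0`, no enclosing weakly outer trapped surface in its exterior region)
whose exterior region is the *connected* exterior region of the end `e`, compact modulo it
(`IsExteriorRegion e S.exterior`), and contains no surface
weakly outer trapped (`θ⁺ ≤ 0`) towards the end `e`, i.e. bounding an open region away from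
`e` with normal pointing towards `e` (`IsWeaklyOuterTrappedFree D.h D.k e S.exterior`: `S`
encloses the whole outermost trapped region of the end `e`, as when `S` is its boundary — the
apparent horizon of Andersson–Metzger 2009), the ADM mass `m = √(E² - |P|²)` satisfies
`√(|S| / 16π) ≤ m`. This is the sub-case of the conjecture in which the region inside the
horizon is kept as part of a complete manifold `X` (rather than data with boundary `∂X = S`).
Open; stated as a `Prop` only. *Caveat:* built on `OutermostMOTS`, whose normal field `S.ν`
carries no regularity (docstring heading the section *gr.S09* above); the intended conjecture is
this statement with `S.ν` smooth as a map into `TX`.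
[cite: AnderssonMetzgerTrapped2009, Defs. 7.1–7.2 and Thm. 7.3 (arXiv:0708.4252 numbering)] -/
@[conjecture] def PenroseInequalityConjecture : Prop :=
  ∀ (X : Type) [TopologicalSpace X] [ChartedSpace E3 X] [IsManifold (𝓡 3) ∞ X] [T2Space X]
    [SecondCountableTopology X] [ConnectedSpace X]
    (D : InitialDataSet (𝓡 3) X) [D.metric.HasLeviCivita] (e : AFEnd X)
    (S : OutermostMOTS (𝓡 3) D.h D.k),
    D.SatisfiesDominantEnergyCondition → e.IsAsymptoticallyFlat D 1 → D.IsComplete →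
    (∃ m, e.HasADMEnergy D m) → (∀ i, ∃ p, e.HasADMMomentum D i p) →
    IsWeaklyOuterTrappedFree D.h D.k e S.exterior → IsExteriorRegion e S.exterior →
    Real.sqrt (S.surfaceArea.toReal / (16 * π)) ≤ e.admMass D

end Literature.Geometry.Lorentzian

end
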